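import Summits.AtomisticToContinuum.Crystallization.Theorems.HullExactificationCascadeHcpLandscapeGapStubFibreCharge

/-!
# Crux `HcpLandscapeGap` (stmt-AtomisticToContinuum-12087), line `birth` — stub `stub_slipFibreCharge`

STUB slip-X1 of the skeleton `Cruxes/HcpLandscapeGap/Lines/birth.lean`: pure one-dimensional
counting used in the assembly of the energy inequality for laterally slipped layered sets.
In a vertical fibre of layers `k ∈ [M₁, M₂]` a site is *bad* only if the in-layer scale is off
(`δ₁ < |a' - a|`; then all sites are bad), or within `K` layers there is a cubic bond
`s (k' + 1) = s k'`, an off spacing (`δ₁ < |H (k' + 1) - H k' - h|`) or an off lateral deviation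
(`δ₁ < d k'`).  With the column price
`P = ∑_{k ∈ [M₁, M₂]} ([s (k+1) = s k] + (a' - a)² + (H (k+1) - H k - h)² + (d k)²)` we show
`#bad ≤ (2K+1)(1 + δ₁⁻²) P + 6K(2K+1)`:

* if `δ₁ < |a' - a|`, then `#bad ≤ #[M₁, M₂] ≤ δ₁⁻² ∑_k (a' - a)² ≤ δ₁⁻² P`;
* otherwise `bad` is covered by the window sets of the faults, of the off spacings and of the off
  deviations; by `FibreCharge.card_window_le` each window set has at most
  `(2K+1) (#{k' ∈ [M₁, M₂] : Q k'} + 2K)` layers, and by Chebyshev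
  (`FibreCharge.card_le_inv_mul_sum`) `#faults ≤ ∑ [s (k+1) = s k]`,
  `#off spacings ≤ δ₁⁻² ∑ (H (k+1) - H k - h)²` and `#off deviations ≤ δ₁⁻² ∑ (d k)²`; the three
  partial prices add up to at most `(1 + δ₁⁻²) P`, and the three boundary terms to `6K(2K+1)`.

All [folklore] (elementary counting); adapted from the landed stub `stub_fibreCharge`.
-/

namespace Summit.AtomisticToContinuum.Crystallization.Theorems.HcpLandscapeGapBirth

open Finset

namespace SlipFibreCharge

/-- Bookkeeping in the off-scale case: if the bad layers number at most `c ≤ ι · SA` (all layers,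
charged to the scale price), then they number at most `(2K+1)(1 + ι)(SF + SA + SO + SD) + 6K(2K+1)`.
[folklore] -/
theorem charge_scale {N c SF SA SO SD K ι : ℝ} (hK : 0 ≤ K) (hι : 0 ≤ ι) (hF0 : 0 ≤ SF)
    (hO0 : 0 ≤ SO) (hD0 : 0 ≤ SD) (hA0 : 0 ≤ SA) (hN : N ≤ c) (hc : c ≤ ι * SA) :
    N ≤ (2 * K + 1) * (1 + ι) * (SF + SA + SO + SD) + 6 * K * (2 * K + 1) := by
  have e1 : 0 ≤ ι * (SF + SO + SD) := mul_nonneg hι (by linarith)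
  have e2 : 0 ≤ K * ((1 + ι) * (SF + SA + SO + SD)) :=
    mul_nonneg hK (mul_nonneg (by linarith) (by linarith))
  have e3 : 0 ≤ K * (2 * K + 1) := mul_nonneg hK (by linarith)
  linarith

/-- Bookkeeping in the windowed case: three window counts `(2K+1)(c + 2K)`, with `cF ≤ SF`,
`cO ≤ ι · SO` and `cD ≤ ι · SD`, add up to at most `(2K+1)(1 + ι)(SF + SA + SO + SD) + 6K(2K+1)`.
[folklore] -/
theorem charge_three_windows {N cF cO cD SF SA SO SD K ι : ℝ} (hK : 0 ≤ K) (hι : 0 ≤ ι)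
    (hF0 : 0 ≤ SF) (hA0 : 0 ≤ SA) (hO0 : 0 ≤ SO) (hD0 : 0 ≤ SD)
    (hN : N ≤ (2 * K + 1) * (cF + 2 * K) + (2 * K + 1) * (cO + 2 * K) +
      (2 * K + 1) * (cD + 2 * K))
    (hcF : cF ≤ SF) (hcO : cO ≤ ι * SO) (hcD : cD ≤ ι * SD) :
    N ≤ (2 * K + 1) * (1 + ι) * (SF + SA + SO + SD) + 6 * K * (2 * K + 1) := by
  have hK1 : 0 ≤ 2 * K + 1 := by linarith
  have e1 : (2 * K + 1) * cF ≤ (2 * K + 1) * SF := mul_le_mul_of_nonneg_left hcF hK1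
  have e2 : (2 * K + 1) * cO ≤ (2 * K + 1) * (ι * SO) := mul_le_mul_of_nonneg_left hcO hK1
  have e3 : (2 * K + 1) * cD ≤ (2 * K + 1) * (ι * SD) := mul_le_mul_of_nonneg_left hcD hK1
  have e4 : 0 ≤ (2 * K + 1) * (SA + SO + SD) := mul_nonneg hK1 (by linarith)
  have e5 : 0 ≤ (2 * K + 1) * ι * (SF + SA) := mul_nonneg (mul_nonneg hK1 hι) (by linarith)
  linarith

end SlipFibreCharge

open FibreCharge SlipFibreCharge in
/-- **Stub slip-X1 (`stub_slipFibreCharge`).**  In a fibre of layers `k ∈ [M₁, M₂]`, the number of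
layers that see an off in-layer scale, or within `K` layers a cubic bond, an off spacing or an
off lateral deviation, is at most `(2K+1)(1 + δ₁⁻²) P + 6K(2K+1)`, where
`P = ∑_{k ∈ [M₁, M₂]} ([s (k+1) = s k] + (a' - a)² + (H (k+1) - H k - h)² + (d k)²)` is the column
price. [folklore] -/
theorem stub_slipFibreCharge : ∀ (K : ℕ) (δ₁ : ℝ), 0 < δ₁ → ∀ (s : ℤ → ℤ) (H : ℤ → ℝ) (d : ℤ → ℝ)
    (a a' h : ℝ) (M₁ M₂ : ℤ), (Set.ncard {k : ℤ | M₁ ≤ k ∧ k ≤ M₂ ∧ (δ₁ < |a' - a| ∨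
      (∃ k' : ℤ, |k' - k| ≤ K ∧ s (k' + 1) = s k') ∨
      (∃ k' : ℤ, |k' - k| ≤ K ∧ δ₁ < |H (k' + 1) - H k' - h|) ∨
      (∃ k' : ℤ, |k' - k| ≤ K ∧ δ₁ < d k'))} : ℝ) ≤
    (2 * K + 1) * (1 + δ₁⁻¹ ^ 2) * (∑ k ∈ Finset.Icc M₁ M₂, ((if s (k + 1) = s k then (1 : ℝ)
      else 0) + (a' - a) ^ 2 + (H (k + 1) - H k - h) ^ 2 + (d k) ^ 2)) + 6 * K * (2 * K + 1) := by
  intro K δ₁ hδ s H d a a' h M₁ M₂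
  classical
  -- split the column price into its four partial prices
  simp only [sum_add_distrib]
  have hKn : (0 : ℝ) ≤ K := Nat.cast_nonneg K
  have hδ2 : 0 < δ₁ ^ 2 := by positivity
  have hi0 : (0 : ℝ) ≤ δ₁⁻¹ ^ 2 := by positivity
  have hF0 : 0 ≤ ∑ k ∈ Icc M₁ M₂, (if s (k + 1) = s k then (1 : ℝ) else 0) :=
    sum_nonneg fun k _ => by positivity
  have hA0 : (0 : ℝ) ≤ ∑ _k ∈ Icc M₁ M₂, (a' - a) ^ 2 := sum_nonneg fun k _ => by positivity
  have hO0 : 0 ≤ ∑ k ∈ Icc M₁ M₂, (H (k + 1) - H k - h) ^ 2 := sum_nonneg fun k _ => by positivity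
  have hD0 : 0 ≤ ∑ k ∈ Icc M₁ M₂, (d k) ^ 2 := sum_nonneg fun k _ => by positivity
  -- the bad set
  set B : Set ℤ := {k : ℤ | M₁ ≤ k ∧ k ≤ M₂ ∧ (δ₁ < |a' - a| ∨
      (∃ k' : ℤ, |k' - k| ≤ K ∧ s (k' + 1) = s k') ∨
      (∃ k' : ℤ, |k' - k| ≤ K ∧ δ₁ < |H (k' + 1) - H k' - h|) ∨
      (∃ k' : ℤ, |k' - k| ≤ K ∧ δ₁ < d k'))} with hB
  by_cases ha : δ₁ < |a' - a|
  · -- case (i): all layers are bad, and the scale price of each layer is at least `δ₁²`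
    have hsub : B ⊆ ↑(Icc M₁ M₂) := by
      intro k hk
      rw [hB, Set.mem_setOf_eq] at hk
      rw [coe_Icc, Set.mem_Icc]
      exact ⟨hk.1, hk.2.1⟩
    have h1 := Set.ncard_le_ncard hsub (finite_toSet _)
    rw [Set.ncard_coe_finset] at h1
    have hsq : δ₁ ^ 2 ≤ (a' - a) ^ 2 := (sq_lt_sq.mpr (by rwa [abs_of_pos hδ])).le
    have h2 : (#(Icc M₁ M₂) : ℝ) ≤ (δ₁ ^ 2)⁻¹ * ∑ _k ∈ Icc M₁ M₂, (a' - a) ^ 2 :=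
      card_le_inv_mul_sum (subset_refl _) (fun _ => (a' - a) ^ 2) hδ2 (fun _ _ => sq_nonneg _)
        fun _ _ => hsq
    rw [← inv_pow] at h2
    exact charge_scale hKn hi0 hF0 hO0 hD0 hA0 (by exact_mod_cast h1) h2
  · -- case (ii): a bad layer sees a fault, an off spacing or an off deviation within `K` layers
    have hsub : B ⊆ ↑(((Icc M₁ M₂).filter fun k => ∃ k' : ℤ, |k' - k| ≤ (K : ℤ) ∧
        s (k' + 1) = s k') ∪ ((Icc M₁ M₂).filter fun k => ∃ k' : ℤ, |k' - k| ≤ (K : ℤ) ∧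
        δ₁ < |H (k' + 1) - H k' - h|) ∪ ((Icc M₁ M₂).filter fun k => ∃ k' : ℤ,
        |k' - k| ≤ (K : ℤ) ∧ δ₁ < d k')) := by
      intro k hk
      rw [hB, Set.mem_setOf_eq] at hk
      obtain ⟨h1, h2, h3⟩ := hk
      rcases h3 with h3 | h3 | h3 | h3
      · exact absurd h3 ha
      · exact mem_coe.mpr (mem_union_left _ (mem_union_left _
          (mem_filter.mpr ⟨mem_Icc.mpr ⟨h1, h2⟩, h3⟩)))
      · exact mem_coe.mpr (mem_union_left _ (mem_union_right _
          (mem_filter.mpr ⟨mem_Icc.mpr ⟨h1, h2⟩, h3⟩)))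
      · exact mem_coe.mpr (mem_union_right _ (mem_filter.mpr ⟨mem_Icc.mpr ⟨h1, h2⟩, h3⟩))
    have h1 := Set.ncard_le_ncard hsub (finite_toSet _)
    rw [Set.ncard_coe_finset] at h1
    -- window counts
    have hF := card_window_le K (fun k => s (k + 1) = s k) M₁ M₂
    have hO := card_window_le K (fun k => δ₁ < |H (k + 1) - H k - h|) M₁ M₂
    have hD := card_window_le K (fun k => δ₁ < d k) M₁ M₂
    have hnat : Set.ncard B ≤
        (2 * K + 1) * (#((Icc M₁ M₂).filter fun k => s (k + 1) = s k) + 2 * K) +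
        (2 * K + 1) * (#((Icc M₁ M₂).filter fun k => δ₁ < |H (k + 1) - H k - h|) + 2 * K) +
        (2 * K + 1) * (#((Icc M₁ M₂).filter fun k => δ₁ < d k) + 2 * K) :=
      h1.trans <| (card_union_le _ _).trans <|
        (Nat.add_le_add_right (card_union_le _ _) _).trans <|
          Nat.add_le_add (Nat.add_le_add (by convert hF) (by convert hO)) (by convert hD)
    have hreal : (Set.ncard B : ℝ) ≤
        (2 * K + 1) * (#((Icc M₁ M₂).filter fun k => s (k + 1) = s k) + 2 * K) +
        (2 * K + 1) * (#((Icc M₁ M₂).filter fun k => δ₁ < |H (k + 1) - H k - h|) + 2 * K) +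
        (2 * K + 1) * (#((Icc M₁ M₂).filter fun k => δ₁ < d k) + 2 * K) := by
      exact_mod_cast hnat
    -- the faults, the off spacings and the off deviations are paid by their partial prices
    have hF1 : ∀ k ∈ (Icc M₁ M₂).filter (fun k => s (k + 1) = s k),
        (1 : ℝ) ≤ (if s (k + 1) = s k then (1 : ℝ) else 0) := by
      intro k hk
      rw [mem_filter] at hk
      rw [if_pos hk.2]
    have hcF : (#((Icc M₁ M₂).filter fun k => s (k + 1) = s k) : ℝ) ≤
        ∑ k ∈ Icc M₁ M₂, (if s (k + 1) = s k then (1 : ℝ) else 0) := by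
      simpa using card_le_inv_mul_sum (filter_subset _ (Icc M₁ M₂))
        (fun k => if s (k + 1) = s k then (1 : ℝ) else 0) one_pos
        (fun k _ => by positivity) hF1
    have hO1 : ∀ k ∈ (Icc M₁ M₂).filter (fun k => δ₁ < |H (k + 1) - H k - h|),
        δ₁ ^ 2 ≤ (H (k + 1) - H k - h) ^ 2 := by
      intro k hk
      rw [mem_filter] at hk
      exact (sq_lt_sq.mpr (by rw [abs_of_pos hδ]; exact hk.2)).le
    have hcO : (#((Icc M₁ M₂).filter fun k => δ₁ < |H (k + 1) - H k - h|) : ℝ) ≤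
        δ₁⁻¹ ^ 2 * ∑ k ∈ Icc M₁ M₂, (H (k + 1) - H k - h) ^ 2 := by
      rw [inv_pow]
      exact card_le_inv_mul_sum (filter_subset _ (Icc M₁ M₂))
        (fun k => (H (k + 1) - H k - h) ^ 2) hδ2 (fun k _ => sq_nonneg _) hO1
    have hD1 : ∀ k ∈ (Icc M₁ M₂).filter (fun k => δ₁ < d k), δ₁ ^ 2 ≤ (d k) ^ 2 := by
      intro k hk
      rw [mem_filter] at hk
      exact pow_le_pow_left₀ hδ.le hk.2.le 2
    have hcD : (#((Icc M₁ M₂).filter fun k => δ₁ < d k) : ℝ) ≤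
        δ₁⁻¹ ^ 2 * ∑ k ∈ Icc M₁ M₂, (d k) ^ 2 := by
      rw [inv_pow]
      exact card_le_inv_mul_sum (filter_subset _ (Icc M₁ M₂)) (fun k => (d k) ^ 2) hδ2
        (fun k _ => sq_nonneg _) hD1
    exact charge_three_windows hKn hi0 hF0 hA0 hO0 hD0 hreal hcF hcO hcD

end Summit.AtomisticToContinuum.Crystallization.Theorems.HcpLandscapeGapBirth
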